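import Literature.MathematicalPhysics.QuantumFieldTheory.Balaban1983to89.BlockAveragingSection
import Literature.MathematicalPhysics.QuantumFieldTheory.BalabanImbrieJaffe1984to88.BIJ85Eq453GaugeField

/-!
# `Balaban1983to89.BlockAveragingSectionQsstar` — the pull-back `Q^{s*}_k` of [BalabanImbrieJaffe1985] (4.5.3) ∕ [Balaban1988Convergent]
# (1.3), (2.16) IS the face section of Bałaban's (0.4) averaging: `M(Q^{s*}V) = V` and `M^k(Q^{s*}_k V) = V` for the SMEARED block averaging

Cell `pub-ymgap` (HUMAN RULING D-0062), Track A, node N20; seat `pub-ymgap-dag-n20-d` (generation 4).  Theorems only (0 `def`, 0 `sorry`,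
standard axioms).  Pure lattice bookkeeping; nothing here is an estimate and nothing of Bałaban's is asserted.

WHY.  The tree carries TWO names for one configuration on `T^{(j)}` built from a coarse `V` on `T^{(j+1)}`:
* r∕p31's `BIJ85Eq453GaugeField.qsstarG V` — (4.5.3) p. 312 of [BalabanImbrieJaffe1985] = (1.3) p. 246 of [Balaban1988Convergent]:
  `1` on bonds inside a block, `V(c)` on the corridor bonds of `c` — the configuration through which the (2.16) local backgrounds
  `U_{k,□}(V_k) = U(𝐁_k(□^{∼4}), M˙(Q_k^{s*}V_k))` of [Balaban1988Convergent] p. 257 (`B14.Eq216Concrete.ukBox`, NODE 00's `chiOfRecord` ∕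
  `chiSeqOfRecord`) read their data;
* ym3's `BlockAveragingSection.faceSec V` — `V(c)` on the bonds exiting their block, `1` elsewhere — for which the SECTION PROPERTY under
  Bałaban's (0.4) averaging `BlockAveraging.avgFun ℰ` is PROVED (`BlockAveragingSection.avgFun_faceSec`, every small-loop average with
  `ℰ(1,…,1) = 1`, e.g. the printed exp[mean log]).
The section property of `Q^{s*}` itself is in the tree only for the AXIAL (straight-line) averaging (`BIJ85Eq453GaugeField.axialAvg_qsstarG`,
`iter_axial_qsstarGIter0`).  This file proves the two names agree (standing range) and transports the section property to `Q^{s*}`, one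
step and `k`-fold: print's «QQ^{s*} = I» ([BalabanImbrieJaffe1985] (2.19) p. 305) for the SMEARED averaging, which is what the (2.12)
constraint «M_𝐁(U) = V on the determining set» means at the top scale when the data are `M˙(Q_k^{s*}V_k)` ([Balaban1988Convergent] p. 267
l. 5–7 «By the definition of these configurations, and the constraints on V_k, we have M^{k+1}(U_{k+1}) = V_{k+1} = M^{k+1}(U_{k+1,□′}) on □′~»).

CONTENT (standing range `j + 1 ≤ m + K`).
* §1 `exitsBlock_iff_blockOf_ne` (a fine bond exits its block iff its endpoints lie in different blocks), **`qsstarG_eq_faceSec`**.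
* §2 **`avgFun_qsstarG`** ∕ `blockAvg_qsstarG` (`Ū = V` for `U = Q^{s*}V` under `avgFun ℰ`, `ℰ(1,…,1) = 1`), **`iter_blockAvg_qsstarGIter0`**
  (`M^k(Q^{s*}_k V) = V`, `k ≤ m + K`), `iter_blockAvg_qsstarGIter0_trivial` (the axial case as the instance `ℰ = trivial`, `rfl` hypothesis).

References: T. Bałaban, J. Imbrie, A. Jaffe, CMP 97 (1985) 299 [BalabanImbrieJaffe1985] ((2.19) p.305, (4.5.3) p.312); T. Bałaban, CMP 109 (1987) 249
[Balaban1987RG1] ((0.4) p.253); CMP 119 (1988) 243 [Balaban1988Convergent] ((1.3) p.246, (2.16) p.257, p.267).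
-/

noncomputable section

namespace Literature.MathematicalPhysics.QuantumFieldTheory.Balaban1983to89.BlockAveragingSectionQsstar

open T4Continuum AveragingRT BlockAveraging BlockAveragingSection
open Literature.MathematicalPhysics.QuantumFieldTheory.BalabanImbrieJaffe1984to88.BIJ85Eq453GaugeField
  (qsstarG qsstarGIter0 qsstarG_apply qsstarGIter0_succ qsstarGIter0_zero qsstarG_blockSite)

variable {P : Params} {j : ℕ} {G : Type*} [GaugeGroup G]

/-! ## §1 The pull-back `Q^{s*}` is the face section -/

/-- Every fine site is the block site of its block with the in-block offsets `(x_μ mod L)_μ` (standing range). [cite: Balaban1987RG1, (0.3) p.252] -/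
theorem eq_blockSite_blockEquiv (hj : j + 1 ≤ P.m + P.K) (x : Site P j) :
    x = Site.blockSite (blockOf x) (Site.blockEquiv hj (blockOf x) ⟨x, rfl⟩) :=
  (congrArg Subtype.val ((Site.blockEquiv hj (blockOf x)).symm_apply_apply ⟨x, rfl⟩)).symm

/-- A fine bond `⟨x, x + e_μ⟩` EXITS ITS BLOCK (`x_μ ≡ L − 1 (mod L)`, ym3's `ExitsBlock`) iff its endpoints lie in different blocks
(`blockOf b₊ ≠ blockOf b₋`, the corridor case of (4.5.3)) — standing range. [cite: BalabanImbrieJaffe1985, (4.5.3) p.312] -/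
theorem exitsBlock_iff_blockOf_ne (hj : j + 1 ≤ P.m + P.K) (b : PBond P j) :
    ExitsBlock b ↔ blockOf b.tgt ≠ blockOf b.src := by
  obtain ⟨x, μ⟩ := b
  have hL := P.hL.2
  have hx := eq_blockSite_blockEquiv hj x
  set r : Fin P.d → Fin P.L := Site.blockEquiv hj (blockOf x) ⟨x, rfl⟩ with hr
  set y : Site P (j + 1) := blockOf x with hy
  have htgt : blockOf (PBond.tgt ⟨x, μ⟩) = if (r μ : ℕ) + 1 = P.L then y.shift μ else y := by
    show blockOf (x.shift μ) = _
    conv_lhs => rw [hx]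
    exact BalabanImbrieJaffe1984to88.BIJ85CurlQsstar.blockOf_shift_blockSite hj y r μ
  have hval : (x μ).val % P.L = (r μ : ℕ) := by
    conv_lhs => rw [hx]
    rw [Site.val_blockSite hj, Nat.mul_add_mod', Nat.mod_eq_of_lt (r μ).isLt]
  have hne : y.shift μ ≠ y := by
    intro h
    have h1 := congrFun h μ
    simp only [Site.shift, Function.update_self] at h1
    exact one_ne_zero (add_eq_left.1 h1)
  show (x μ).val % P.L = P.L - 1 ↔ blockOf (PBond.tgt ⟨x, μ⟩) ≠ blockOf x
  rw [hval, htgt, ← hy]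
  constructor
  · intro h
    rw [if_pos (by omega)]
    exact hne
  · intro h
    by_contra hc
    exact h (by rw [if_neg (by omega)])

/-- **`Q^{s*}V = faceSec V`**: the pull-back (4.5.3) of [BalabanImbrieJaffe1985] (= (1.3) of [Balaban1988Convergent]) IS ym3's face section
of the (0.4) averaging — `V(c)` on the bonds crossing the face of `c`, `1` on all other bonds (standing range). [cite: BalabanImbrieJaffe1985, (4.5.3) p.312] -/
theorem qsstarG_eq_faceSec (hj : j + 1 ≤ P.m + P.K) (V : GaugeField P (j + 1) G) : qsstarG V = faceSec V := by
  funext b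
  rw [qsstarG_apply]
  by_cases h : ExitsBlock b
  · rw [faceSec_of_exits V h, if_neg ((exitsBlock_iff_blockOf_ne hj b).1 h)]
  · rw [faceSec_of_not_exits V h, if_pos (not_ne_iff.1 fun hne => h ((exitsBlock_iff_blockOf_ne hj b).2 hne))]

/-! ## §2 The section property of `Q^{s*}` under Bałaban's (0.4) averaging, one step and `k`-fold -/

/-- **`M(Q^{s*}V) = V` FOR THE SMEARED (0.4) AVERAGING**: for every small-loop average `ℰ` with `ℰ(1,…,1) = 1` (the printed exp[mean log],
the trivial average), `avgFun ℰ (qsstarG V) = V` — the group-valued «QQ^{s*} = I» of [BalabanImbrieJaffe1985] (2.19) for Bałaban's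
averaging, via `BlockAveragingSection.avgFun_faceSec` (standing range). [cite: BalabanImbrieJaffe1985, (2.19) p.305] -/
theorem avgFun_qsstarG (hj : j + 1 ≤ P.m + P.K) (ℰ : LoopAverage G) (hE : ∀ n : ℕ, ℰ.E (fun _ : Fin (n + 1) => (1 : G)) = 1)
    (V : GaugeField P (j + 1) G) : avgFun ℰ (qsstarG V) = V := by
  rw [qsstarG_eq_faceSec hj]
  exact avgFun_faceSec hj ℰ hE V

/-- The same for the `Averaging` structure `blockAvg ℰ`. [cite: BalabanImbrieJaffe1985, (2.19) p.305] -/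
theorem blockAvg_qsstarG (hj : j + 1 ≤ P.m + P.K) (ℰ : LoopAverage G) (hE : ∀ n : ℕ, ℰ.E (fun _ : Fin (n + 1) => (1 : G)) = 1)
    (V : GaugeField P (j + 1) G) : (blockAvg ℰ).avg (qsstarG V) = V := by
  rw [blockAvg_avg]
  exact avgFun_qsstarG hj ℰ hE V

/-- **`M^k(Q^{s*}_k V) = V` FOR THE SMEARED (0.4) AVERAGING**: the `k`-fold pull-back `qsstarGIter0 k V` from the unit lattice `T^{(k)}` to the
finest torus `T^{(0)}` has the prescribed `k`-fold averages `V` under `Averaging.iter (blockAvg ℰ)`, every `ℰ` with `ℰ(1,…,1) = 1`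
(`k ≤ m + K`) — the rôle in which [Balaban1988Convergent] (2.16) uses `Q_k^{s*}V_k` as data of the variational problem (2.12): p. 267 l. 5–7
«M^{k+1}(U_{k+1}) = V_{k+1} = M^{k+1}(U_{k+1,□′}) on □′~ by the constraints». [cite: Balaban1988Convergent, (2.16) p.257] -/
theorem iter_blockAvg_qsstarGIter0 (ℰ : LoopAverage G) (hE : ∀ n : ℕ, ℰ.E (fun _ : Fin (n + 1) => (1 : G)) = 1) :
    ∀ (k : ℕ), k ≤ P.m + P.K → ∀ V : GaugeField P k G,
      Averaging.iter (fun i => blockAvg (P := P) (j := i) ℰ) k (qsstarGIter0 k V) = V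
  | 0, _, _ => rfl
  | k + 1, hk, V => by
    rw [qsstarGIter0_succ]
    show (blockAvg ℰ).avg (Averaging.iter (fun i => blockAvg (P := P) (j := i) ℰ) k (qsstarGIter0 k (qsstarG V))) = V
    rw [iter_blockAvg_qsstarGIter0 ℰ hE k (by omega) (qsstarG V), blockAvg_qsstarG hk ℰ hE V]

/-- The axial case as an instance: `ℰ = LoopAverage.trivial` (hypothesis `rfl`; cf. `BIJ85Eq453GaugeField.iter_axial_qsstarGIter0` for the
`AveragingRT.axial` structure). [cite: BalabanImbrieJaffe1985, (2.19) p.305] -/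
theorem iter_blockAvg_qsstarGIter0_trivial {k : ℕ} (hk : k ≤ P.m + P.K) (V : GaugeField P k G) :
    Averaging.iter (fun i => blockAvg (P := P) (j := i) (LoopAverage.trivial G)) k (qsstarGIter0 k V) = V :=
  iter_blockAvg_qsstarGIter0 _ (fun _ => rfl) k hk V

end Literature.MathematicalPhysics.QuantumFieldTheory.Balaban1983to89.BlockAveragingSectionQsstar

end
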